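import Mathlib

/-!
# The printed scalar toolkit admits variance-budget violators (negative lemma for crux stmt-SmoothPoincare4-10870)

The picked line `cgy-variance-pivot` for crux `EntropyRung.CompactShrinkerGap` is closed (lead's skeleton v2,
2026-08-16) modulo its transfer target STUB 1, the variance budget `D < 2V − 96π²` for a closed normalised
gradient shrinker `Ric + Hess f = g/2`, `R + |∇f|² = f` on `M ≃ₕ S⁴` with `Z = ∫e^{-f} dV > Z₀ = 32π²√π e^{-3/2}`
(`V = Vol(M,g)`, `D = ∫(R − 2)² dV`). Everything print and tree offer about the SCALAR summary
`(V, Z, D, f_max, f_min, R_min)` of such a shrinker is the list (T1)–(T10) below. Results (pure real arithmetic;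
the geometric provenance of each conjunct is in the comments):
* `scalarToolkit_witness`, `not_budget_of_scalarToolkit`: (T1)–(T10) hold at the explicit tuple
  `(95π², 0.99·e^{-2}·95π², 100π², 4, 1, ½)`, which VIOLATES the budget (`2V − 96π² = 94π² ≤ 100π² = D`): no
  arithmetic over the printed inequalities proves STUB 1.
* `budget_of_crz_of_fmax_le_three`, `budget_of_bhatiaDavis_of_fmax_le`: the single missing scalar is a sup
  bound on `f_max = R_max` — `≤ 3` suffices via CRZ (ceiling `c* = 3.0807`, `CrzArithmeticBeyondThreeFalse.lean`),
  `≤ 2.48` via Bhatia–Davis (threshold `2.4867 < 2.5276 = R_max` of Koiso–Cao).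
* `weightedIdentities_cannot_bound_variance`: distribution-level sharpening — three-atom volume distributions with
  `0 < R ≤ f`, `∫R = 2V`, the EXACT weighted identity `∫(f−2)e^{-f} = 0`, Jensen, density up to slack `2m`, and
  `D/V ≥ 1/(4m)` unbounded: pinning the `dV`-law of `f` near `2` (which the density does) does not pin `R`.
Refuter negative lemma (cdisprove gen 4), supports the crux item.
-/

namespace Summit.SmoothPoincare4.SmoothPoincare4.Theorems.CompactShrinkerGap.Negative

/-!
THE PRINTED SCALAR TOOLKIT for a closed normalised 4-d gradient shrinker with density above the cylinder, in the
variables `V = Vol`, `Z = ∫e^{-f}dV`, `D = ∫(R−2)²dV`, `fmax = sup f = sup R`, `fmin = inf f`, `Rmin = inf R`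
(no `def` is introduced; the conjuncts are inlined in each statement, in this order):
(T1) density floor `Z₀ = 32π²√π e^{-3/2} < Z` (crux hypothesis);
(T2) Jensen `Z ≤ e^{-2}V` (Cao–Hamilton–Ilmanen 2004 §4; landed `stub_jensenVolumeBound`, p71839);
(T3) `e^{-fmax}V ≤ Z ≤ e^{-fmin}V`;
(T4) `0 < Rmin ≤ fmin < 2 < fmax` (`R > 0` landed p71988; `f_min = R(argmin f) ≥ R_min`; the `e^{-f}dV`-mean of `f`
     is `2`, strict window unless Einstein; `f_max = R_max`, CRZ Rem. 1);
(T5) Cheng–Ribeiro–Zhou coarea bound `D ≤ ½(e^{fmax}Z − V)` (arXiv:2203.14916 §3.2; the skeleton's `CRZSharpBound`);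
(T6) CRZ Thm. 1 at `χ = 2` (⟺ via CGB and `∫σ₂ = V/6 − D/12`): `D ≤ ½V(e^{fmax−fmin} − 1)`;
(T7) CRZ Thm. 2 `V(5 − e^{osc f}) ≤ 384π²` ⟺ Gursky `∫σ₂ ≤ Y²/24 ≤ 16π²` ⟺ CGB(`χ = 2`) with `∫|W|² ≥ 0`:
     `2V − 192π² ≤ D`;
(T8) Catino 2016 integral pinching (arXiv:1509.07416 Rem. 1.3), non-round branch: `18V − 1536π² < 15D`;
(T9) Bhatia–Davis with `∫R dV = 2V`, `Rmin ≤ R ≤ Rmax = fmax`: `D ≤ V(fmax − 2)(2 − Rmin)`;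
(T10) `0 ≤ D`, `0 < V`.
-/

/-- `32 √π e^{-3/2} < 0.99 · 95 · e^{-2}` (the witness's Gaussian mass clears the bar:
`√π e^{1/2} < 1.7725 · 1.6488 < 2.9391`). [folklore] -/
theorem densityFloor_lt_witness :
    32 * Real.pi ^ 2 * Real.sqrt Real.pi * Real.exp (-(3 : ℝ) / 2) <
      99 / 100 * (Real.exp (-2) * (95 * Real.pi ^ 2)) := by
  have hπ := Real.pi_pos
  have hp2 : 0 < Real.pi ^ 2 := by positivity
  have hs : Real.sqrt Real.pi < 1.7725 := by
    rw [Real.sqrt_lt' (by norm_num)]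
    have := Real.pi_lt_d6; nlinarith
  have he : Real.exp (1 / 2) < 1.6488 := by
    have h2 : Real.exp (1 / 2) ^ 2 < (1.6488 : ℝ) ^ 2 := by
      rw [← Real.exp_nat_mul]; norm_num
      have := Real.exp_one_lt_d9; linarith
    exact lt_of_pow_lt_pow_left₀ 2 (by norm_num) h2
  have hprod : Real.sqrt Real.pi * Real.exp (1 / 2) < 1.7725 * 1.6488 :=
    mul_lt_mul'' hs he (Real.sqrt_nonneg _) (Real.exp_pos _).le
  have hE : Real.exp (-(3 : ℝ) / 2) = Real.exp (-2) * Real.exp (1 / 2) := by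
    rw [← Real.exp_add]; norm_num
  rw [hE]
  have h2 := Real.exp_pos (-2 : ℝ)
  nlinarith [mul_pos h2 hp2]

/-- **The witness**: the tuple `(V, Z, D, fmax, fmin, Rmin) = (95π², 0.99e^{-2}·95π², 100π², 4, 1, ½)`
satisfies every conjunct (T1)–(T10) of the printed scalar toolkit AND violates the variance budget:
`2V − 96π² = 94π² ≤ 100π² = D` (last conjunct). [cite: ChengRibeiroZhou2022, Thm. 1, Thm. 2 and §3.2] -/
theorem scalarToolkit_witness :
    -- (T1)
    32 * Real.pi ^ 2 * Real.sqrt Real.pi * Real.exp (-(3 : ℝ) / 2) <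
        99 / 100 * (Real.exp (-2) * (95 * Real.pi ^ 2)) ∧
    -- (T2)
    99 / 100 * (Real.exp (-2) * (95 * Real.pi ^ 2)) ≤ Real.exp (-2) * (95 * Real.pi ^ 2) ∧
    -- (T3)
    (Real.exp (-4) * (95 * Real.pi ^ 2) ≤ 99 / 100 * (Real.exp (-2) * (95 * Real.pi ^ 2)) ∧
      99 / 100 * (Real.exp (-2) * (95 * Real.pi ^ 2)) ≤ Real.exp (-1) * (95 * Real.pi ^ 2)) ∧
    -- (T4)
    ((0 : ℝ) < 1 / 2 ∧ (1 / 2 : ℝ) ≤ 1 ∧ (1 : ℝ) < 2 ∧ (2 : ℝ) < 4) ∧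
    -- (T5)
    100 * Real.pi ^ 2 ≤ 1 / 2 * (Real.exp 4 * (99 / 100 * (Real.exp (-2) * (95 * Real.pi ^ 2))) - 95 * Real.pi ^ 2) ∧
    -- (T6)
    100 * Real.pi ^ 2 ≤ 1 / 2 * (95 * Real.pi ^ 2) * (Real.exp (4 - 1) - 1) ∧
    -- (T7)
    2 * (95 * Real.pi ^ 2) - 192 * Real.pi ^ 2 ≤ 100 * Real.pi ^ 2 ∧
    -- (T8)
    18 * (95 * Real.pi ^ 2) - 1536 * Real.pi ^ 2 < 15 * (100 * Real.pi ^ 2) ∧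
    -- (T9)
    100 * Real.pi ^ 2 ≤ 95 * Real.pi ^ 2 * (4 - 2) * (2 - 1 / 2) ∧
    -- (T10)
    ((0 : ℝ) ≤ 100 * Real.pi ^ 2 ∧ (0 : ℝ) < 95 * Real.pi ^ 2) ∧
    -- the budget is VIOLATED
    2 * (95 * Real.pi ^ 2) - 96 * Real.pi ^ 2 ≤ 100 * Real.pi ^ 2 := by
  have hπ := Real.pi_pos
  have hp2 : 0 < Real.pi ^ 2 := by positivity
  have he1 : 2.7182818283 < Real.exp 1 := Real.exp_one_gt_d9
  have hE2 : Real.exp 2 = Real.exp 1 ^ 2 := by rw [← Real.exp_nat_mul]; norm_num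
  have he2 : 7.38 < Real.exp 2 := by rw [hE2]; nlinarith [Real.exp_pos (1 : ℝ)]
  have he3 : (3 : ℝ) + 1 ≤ Real.exp 3 := Real.add_one_le_exp 3
  have hm2 := Real.exp_pos (-2 : ℝ)
  have hm1 := Real.exp_pos (-1 : ℝ)
  have E42 : Real.exp 4 * Real.exp (-2) = Real.exp 2 := by rw [← Real.exp_add]; norm_num
  have E2m2 : Real.exp 2 * Real.exp (-2) = 1 := by rw [← Real.exp_add]; norm_num
  have Em4 : Real.exp (-4) = Real.exp (-2) * Real.exp (-2) := by rw [← Real.exp_add]; norm_num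
  have hV95 : 0 < 95 * Real.pi ^ 2 := by positivity
  refine ⟨densityFloor_lt_witness, ?_, ⟨?_, ?_⟩, ⟨by norm_num, by norm_num, by norm_num, by norm_num⟩,
    ?_, ?_, ?_, ?_, ?_, ⟨by positivity, by positivity⟩, ?_⟩
  · -- (T2) `0.99 e^{-2} V ≤ e^{-2} V`
    nlinarith [mul_pos hm2 hV95]
  · -- (T3a) `e^{-4} V ≤ 0.99 e^{-2} V` ⟸ `e^{-2} ≤ 0.99`
    have h : Real.exp (-2) ≤ 99 / 100 := by nlinarith
    calc Real.exp (-4) * (95 * Real.pi ^ 2)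
        = Real.exp (-2) * (Real.exp (-2) * (95 * Real.pi ^ 2)) := by rw [Em4]; ring
      _ ≤ 99 / 100 * (Real.exp (-2) * (95 * Real.pi ^ 2)) :=
          mul_le_mul_of_nonneg_right h (by positivity)
  · -- (T3b) `0.99 e^{-2} V ≤ e^{-1} V` ⟸ `e^{-2} ≤ e^{-1}`
    have h : Real.exp (-2) ≤ Real.exp (-1) := Real.exp_le_exp.mpr (by norm_num)
    calc 99 / 100 * (Real.exp (-2) * (95 * Real.pi ^ 2))
        ≤ Real.exp (-2) * (95 * Real.pi ^ 2) := by nlinarith [mul_pos hm2 hV95]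
      _ ≤ Real.exp (-1) * (95 * Real.pi ^ 2) := mul_le_mul_of_nonneg_right h hV95.le
  · -- (T5) `100π² ≤ ½ (e⁴ · 0.99 e^{-2} · 95π² − 95π²) = 47.5π² (0.99 e² − 1)`
    have key : 1 / 2 * (Real.exp 4 * (99 / 100 * (Real.exp (-2) * (95 * Real.pi ^ 2))) - 95 * Real.pi ^ 2)
        = 95 / 2 * Real.pi ^ 2 * (99 / 100 * (Real.exp 4 * Real.exp (-2)) - 1) := by ring
    rw [key, E42]
    nlinarith
  · -- (T6) `100π² ≤ ½ · 95π² · (e³ − 1)`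
    rw [show (4 : ℝ) - 1 = 3 by norm_num]
    nlinarith
  · -- (T7) `2·95π² − 192π² ≤ 100π²`
    nlinarith
  · -- (T8) `18·95π² − 1536π² < 1500π²`
    nlinarith
  · -- (T9) `100π² ≤ 95π² · 2 · (3/2)`
    nlinarith
  · -- violation `94π² ≤ 100π²`
    nlinarith

/-- **The printed scalar toolkit does not imply the variance budget**: it is FALSE that for all reals
`V, Z, D, fmax, fmin, Rmin` the conjuncts (T1)–(T10) imply `D < 2V − 96π²` (STUB 1's inequality,
`stub_varianceBudget` of `Lines/cgy-variance-pivot.lean`). Hence STUB 1 is not a consequence of the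
density floor, Jensen, the Cheng–Ribeiro–Zhou bounds (coarea, Thm. 1, Thm. 2), Chern–Gauss–Bonnet /
Gursky, Catino's pinching and the Bhatia–Davis bound by real arithmetic; some non-scalar input or a new
sup-type bound must enter. [cite: ChengRibeiroZhou2022, Thm. 1, Thm. 2 and §3.2] -/
theorem not_budget_of_scalarToolkit :
    ¬ (∀ V Z D fmax fmin Rmin : ℝ,
        -- (T1) density floor
        32 * Real.pi ^ 2 * Real.sqrt Real.pi * Real.exp (-(3 : ℝ) / 2) < Z →
        -- (T2) Jensen
        Z ≤ Real.exp (-2) * V →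
        -- (T3) sandwich
        (Real.exp (-fmax) * V ≤ Z ∧ Z ≤ Real.exp (-fmin) * V) →
        -- (T4) window
        (0 < Rmin ∧ Rmin ≤ fmin ∧ fmin < 2 ∧ 2 < fmax) →
        -- (T5) CRZ coarea bound
        D ≤ 1 / 2 * (Real.exp fmax * Z - V) →
        -- (T6) CRZ Thm. 1 at χ = 2
        D ≤ 1 / 2 * V * (Real.exp (fmax - fmin) - 1) →
        -- (T7) CRZ Thm. 2 / Gursky / CGB + ∫|W|² ≥ 0
        2 * V - 192 * Real.pi ^ 2 ≤ D →
        -- (T8) Catino pinching, non-round branch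
        18 * V - 1536 * Real.pi ^ 2 < 15 * D →
        -- (T9) Bhatia–Davis
        D ≤ V * (fmax - 2) * (2 - Rmin) →
        -- (T10) signs
        (0 ≤ D ∧ 0 < V) →
        D < 2 * V - 96 * Real.pi ^ 2) := by
  intro h
  obtain ⟨h1, h2, h3, h4, h5, h6, h7, h8, h9, h10, hviol⟩ := scalarToolkit_witness
  have := h (95 * Real.pi ^ 2) (99 / 100 * (Real.exp (-2) * (95 * Real.pi ^ 2))) (100 * Real.pi ^ 2) 4 1 (1 / 2)
    h1 h2 h3 h4 h5 h6 h7 h8 h9 h10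
  exact absurd this (not_lt.mpr hviol)

/-- **What the toolkit lacks is exactly one scalar**: (T1), (T2), (T5) plus the sup bound `fmax ≤ 3` (the
CRZ sub-line's named hypothesis `PotentialLeThree`) already yield the budget — `e³Z ≤ eV`,
`V > e²Z₀ = 32π²√π e^{1/2}` and `(5 − e)√π e^{1/2} > 6`. (Toolkit form of the skeleton's
`varianceBudget_arith`; the admissible ceiling is `c* = 2 + log(5 − 6/(√π e^{1/2})) = 3.0807`, cf.
`Negative/CrzArithmeticBeyondThreeFalse.lean`.) [cite: ChengRibeiroZhou2022, Rem. 2 and §3.2] -/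
theorem budget_of_crz_of_fmax_le_three {V Z D fmax : ℝ}
    (hZ₀ : 32 * Real.pi ^ 2 * Real.sqrt Real.pi * Real.exp (-(3 : ℝ) / 2) < Z)
    (hJ : Z ≤ Real.exp (-2) * V)
    (hD : D ≤ 1 / 2 * (Real.exp fmax * Z - V)) (h3 : fmax ≤ 3) : D < 2 * V - 96 * Real.pi ^ 2 := by
  have hπ := Real.pi_pos
  have E₁ : Real.exp 2 * Real.exp (-2) = 1 := by rw [← Real.exp_add]; norm_num
  have E₂ : Real.exp 3 = Real.exp 1 * Real.exp 2 := by rw [← Real.exp_add]; norm_num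
  have E₃ : Real.exp (-(3 : ℝ) / 2) * Real.exp 2 = Real.exp (1 / 2) := by
    rw [← Real.exp_add]; norm_num
  have hZpos : 0 < Z := lt_trans (by positivity) hZ₀
  -- replace `e^{fmax}` by `e³`
  have hD3 : D ≤ 1 / 2 * (Real.exp 3 * Z - V) := by
    have : Real.exp fmax * Z ≤ Real.exp 3 * Z :=
      mul_le_mul_of_nonneg_right (Real.exp_le_exp.mpr h3) hZpos.le
    linarith
  have hV : Real.exp 2 * Z ≤ V := by
    calc Real.exp 2 * Z ≤ Real.exp 2 * (Real.exp (-2) * V) :=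
          mul_le_mul_of_nonneg_left hJ (Real.exp_pos 2).le
      _ = V := by rw [← mul_assoc, E₁, one_mul]
  have h3Z : Real.exp 3 * Z ≤ Real.exp 1 * V := by
    rw [E₂, mul_assoc]
    exact mul_le_mul_of_nonneg_left hV (Real.exp_pos 1).le
  have hV₀ : 32 * Real.pi ^ 2 * Real.sqrt Real.pi * Real.exp (1 / 2) < V := by
    calc 32 * Real.pi ^ 2 * Real.sqrt Real.pi * Real.exp (1 / 2)
        = (32 * Real.pi ^ 2 * Real.sqrt Real.pi * Real.exp (-(3 : ℝ) / 2)) * Real.exp 2 := by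
          rw [← E₃]; ring
      _ < Z * Real.exp 2 := mul_lt_mul_of_pos_right hZ₀ (Real.exp_pos 2)
      _ ≤ V := by rw [mul_comm]; exact hV
  have hs : (1.77245 : ℝ) < Real.sqrt Real.pi := by
    rw [Real.lt_sqrt (by norm_num)]
    have := Real.pi_gt_d6
    nlinarith
  have ht : (1.6487 : ℝ) < Real.exp (1 / 2) := by
    have h : (1.6487 : ℝ) ^ 2 < Real.exp (1 / 2) ^ 2 := by
      rw [← Real.exp_nat_mul]
      norm_num
      have := Real.exp_one_gt_d9
      linarith
    exact lt_of_pow_lt_pow_left₀ 2 (Real.exp_pos _).le h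
  have ht' : Real.exp (1 / 2) < (1.6488 : ℝ) := by
    have h : Real.exp (1 / 2) ^ 2 < (1.6488 : ℝ) ^ 2 := by
      rw [← Real.exp_nat_mul]
      norm_num
      have := Real.exp_one_lt_d9
      linarith
    exact lt_of_pow_lt_pow_left₀ 2 (by norm_num) h
  have he : Real.exp 1 = Real.exp (1 / 2) ^ 2 := by rw [← Real.exp_nat_mul]; norm_num
  have h5 : (2.2814 : ℝ) < 5 - Real.exp 1 := by
    rw [he]
    nlinarith [ht', Real.exp_pos (1 / 2 : ℝ)]
  have h5e : 0 < 5 - Real.exp 1 := by linarith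
  have hst : (1.77245 : ℝ) * 1.6487 < Real.sqrt Real.pi * Real.exp (1 / 2) :=
    mul_lt_mul'' hs ht (by norm_num) (by norm_num)
  have key : (6 : ℝ) < (5 - Real.exp 1) * (Real.sqrt Real.pi * Real.exp (1 / 2)) := by
    calc (6 : ℝ) < 2.2814 * (1.77245 * 1.6487) := by norm_num
      _ < (5 - Real.exp 1) * (Real.sqrt Real.pi * Real.exp (1 / 2)) :=
          mul_lt_mul'' h5 hst (by norm_num) (by norm_num)
  have hfin : 192 * Real.pi ^ 2 < 5 * V - Real.exp 1 * V := by
    have hp : 0 < 32 * Real.pi ^ 2 := by positivity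
    have h1 : 32 * Real.pi ^ 2 * 6 <
        32 * Real.pi ^ 2 * ((5 - Real.exp 1) * (Real.sqrt Real.pi * Real.exp (1 / 2))) :=
      mul_lt_mul_of_pos_left key hp
    have h2 : (5 - Real.exp 1) * (32 * Real.pi ^ 2 * Real.sqrt Real.pi * Real.exp (1 / 2)) <
        (5 - Real.exp 1) * V :=
      mul_lt_mul_of_pos_left hV₀ h5e
    have h3 : 32 * Real.pi ^ 2 * ((5 - Real.exp 1) * (Real.sqrt Real.pi * Real.exp (1 / 2))) =
        (5 - Real.exp 1) * (32 * Real.pi ^ 2 * Real.sqrt Real.pi * Real.exp (1 / 2)) := by ring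
    have h4 : (5 - Real.exp 1) * V = 5 * V - Real.exp 1 * V := by ring
    linarith
  linarith [hD3, h3Z, hfin]

/-- **The Bhatia–Davis threshold** (the pointwise route): (T1), (T2), (T9) with `Rmin > 0` and the sup
bound `fmax ≤ 2.48` also yield the budget (`D ≤ 2V·0.48 = 0.96V < 2V − 96π²` since `V > 93.44π²`) —
the scalar shadow of the landed `stub_varianceBudget_of_scalarCurvature_le` (p73066). The exact
threshold of this route is `2 + ½(2 − 96π²/V) ≤ 2.4867 < 2.5276 = R_max(Koiso–Cao)`, strictly weaker
than the CRZ ceiling `3.0807` for the SAME scalar `fmax = R_max`. [folklore] -/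
theorem budget_of_bhatiaDavis_of_fmax_le {V Z D fmax Rmin : ℝ}
    (hZ₀ : 32 * Real.pi ^ 2 * Real.sqrt Real.pi * Real.exp (-(3 : ℝ) / 2) < Z)
    (hJ : Z ≤ Real.exp (-2) * V) (hR : 0 < Rmin) (h2 : 2 < fmax)
    (hBD : D ≤ V * (fmax - 2) * (2 - Rmin)) (hV : 0 < V) (h : fmax ≤ 2.48) :
    D < 2 * V - 96 * Real.pi ^ 2 := by
  have hπ := Real.pi_pos
  -- `V > e² Z₀ = 32π²√π e^{1/2} > 93.44π²`
  have E₁ : Real.exp 2 * Real.exp (-2) = 1 := by rw [← Real.exp_add]; norm_num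
  have E₃ : Real.exp (-(3 : ℝ) / 2) * Real.exp 2 = Real.exp (1 / 2) := by
    rw [← Real.exp_add]; norm_num
  have hVZ : Real.exp 2 * Z ≤ V := by
    calc Real.exp 2 * Z ≤ Real.exp 2 * (Real.exp (-2) * V) :=
          mul_le_mul_of_nonneg_left hJ (Real.exp_pos 2).le
      _ = V := by rw [← mul_assoc, E₁, one_mul]
  have hV₀ : 32 * Real.pi ^ 2 * Real.sqrt Real.pi * Real.exp (1 / 2) < V := by
    calc 32 * Real.pi ^ 2 * Real.sqrt Real.pi * Real.exp (1 / 2)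
        = (32 * Real.pi ^ 2 * Real.sqrt Real.pi * Real.exp (-(3 : ℝ) / 2)) * Real.exp 2 := by
          rw [← E₃]; ring
      _ < Z * Real.exp 2 := mul_lt_mul_of_pos_right hZ₀ (Real.exp_pos 2)
      _ ≤ V := by rw [mul_comm]; exact hVZ
  have hs : (1.772 : ℝ) < Real.sqrt Real.pi := by
    rw [Real.lt_sqrt (by norm_num)]
    have := Real.pi_gt_d2; nlinarith
  have he : (1.648 : ℝ) < Real.exp (1 / 2) := by
    have h1 : (1.648 : ℝ) ^ 2 < Real.exp (1 / 2) ^ 2 := by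
      rw [← Real.exp_nat_mul]; norm_num
      have := Real.exp_one_gt_d9; linarith
    exact lt_of_pow_lt_pow_left₀ 2 (Real.exp_pos _).le h1
  have key : (2.92 : ℝ) < Real.sqrt Real.pi * Real.exp (1 / 2) := by nlinarith
  have hp : 0 < 32 * Real.pi ^ 2 := by positivity
  have h93 : 93.44 * Real.pi ^ 2 < V := by nlinarith
  -- `D ≤ V (fmax − 2)(2 − Rmin) ≤ 2 V (fmax − 2) ≤ 0.96 V`
  have hA : 0 ≤ V * (fmax - 2) := mul_nonneg hV.le (by linarith)
  have hB : V * (fmax - 2) * (2 - Rmin) ≤ V * (fmax - 2) * 2 :=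
    mul_le_mul_of_nonneg_left (by linarith) hA
  have hC : V * (fmax - 2) * 2 ≤ V * 0.48 * 2 := by nlinarith
  have hD96 : D ≤ 0.96 * V := by linarith
  nlinarith

/-- **Even the exact weighted identities cannot bound the variance without `sup f`** (distribution-level
sharpening of `not_budget_of_scalarToolkit`). For every `0 < m ≤ ¼` there is a three-atom volume
distribution — bulk atom `A` (fraction `a`, `f = 2`, `R = η ∈ (0,2]`), hot atom `B` (fraction `m`,
`f = R = 1/m`), cold atom `C` (fraction `s = (1 − 2m)e^{1−1/m} ≤ m`, `f = R = 1`) — satisfying the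
pointwise coupling `0 < R ≤ f` (`R > 0`, `R + |∇f|² = f`), the unweighted mean `∫R dV = 2V`, the EXACT
weighted identity `∫(f − 2)e^{-f} dV = 0` (`Δ_f f = 2 − f` integrated), Jensen `∫e^{-f} ≤ e^{-2}V`, and the
density floor up to slack `2m` (`∫e^{-f} dV ≥ (1 − 2m)e^{-2}V`, i.e. admissible for the crux as soon as
`V ≥ 93.6π²/(1 − 2m)`), whose variance `D/V = Σ mass·(R − 2)² ≥ 1/(4m)` is UNBOUNDED as `m → 0`. So the
`dV`-distribution of `f` being pinned near `2` by the density (it is: `Vol{f ≥ 3} < 6 %` at `V = 95π²`)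
does not pin the distribution of `R ≤ f`: all of `∫R dV = 2V` can be carried by a vanishing volume
fraction at `R = f = 1/m`, the bulk being Gaussian-like (`f ≈ 2`, `R ≈ η`). Any proof of STUB 1 must
therefore use structure beyond {scalar toolkit, weighted identities in `f`, `0 < R ≤ f`} — e.g. a sup bound
`f_max ≤ 3.08`, or genuinely tensorial/PDE input. [folklore] -/
theorem weightedIdentities_cannot_bound_variance {m : ℝ} (hm : 0 < m) (hm4 : m ≤ 1 / 4) :
    ∃ a b c fA fB fC RA RB RC : ℝ,
      (0 < a ∧ 0 < b ∧ 0 < c ∧ a + b + c = 1) ∧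
      ((0 < RA ∧ RA ≤ fA) ∧ (0 < RB ∧ RB ≤ fB) ∧ (0 < RC ∧ RC ≤ fC)) ∧
      a * RA + b * RB + c * RC = 2 ∧
      a * ((fA - 2) * Real.exp (-fA)) + b * ((fB - 2) * Real.exp (-fB)) +
          c * ((fC - 2) * Real.exp (-fC)) = 0 ∧
      (1 - 2 * m) * Real.exp (-2) ≤ a * Real.exp (-fA) + b * Real.exp (-fB) + c * Real.exp (-fC) ∧
      a * Real.exp (-fA) + b * Real.exp (-fB) + c * Real.exp (-fC) ≤ Real.exp (-2) ∧
      1 / (4 * m) ≤ a * (RA - 2) ^ 2 + b * (RB - 2) ^ 2 + c * (RC - 2) ^ 2 := by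
  -- the three atoms: bulk A (f = 2, R = η), hot B (f = R = 1/m, mass m), cold C (f = R = 1, mass s)
  set s : ℝ := (1 - 2 * m) * Real.exp (1 - 1 / m) with hs_def
  have h12 : 0 < 1 - 2 * m := by linarith
  have hs_pos : 0 < s := mul_pos h12 (Real.exp_pos _)
  -- `e^{1 - 1/m} ≤ m` (from `1 - 1/x ≤ log x`)
  have hexp_le : Real.exp (1 - 1 / m) ≤ m := by
    have h := Real.one_sub_inv_le_log_of_pos hm
    calc Real.exp (1 - 1 / m) ≤ Real.exp (Real.log m) := Real.exp_le_exp.mpr (by simpa [one_div] using h)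
      _ = m := Real.exp_log hm
  have hs_le : s ≤ m := by
    calc s = (1 - 2 * m) * Real.exp (1 - 1 / m) := hs_def
      _ ≤ 1 * Real.exp (1 - 1 / m) := by
          apply mul_le_mul_of_nonneg_right _ (Real.exp_pos _).le; linarith
      _ ≤ m := by rw [one_mul]; exact hexp_le
  set a : ℝ := 1 - m - s with ha_def
  have ha_pos : 0 < a := by simp only [ha_def]; linarith
  set η : ℝ := (1 - s) / a with hη_def
  have hη_pos : 0 < η := div_pos (by linarith) ha_pos
  have haη : a * η = 1 - s := by
    simp only [hη_def]; field_simp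
  have hη_le : η ≤ 2 := by
    rw [hη_def, div_le_iff₀ ha_pos, ha_def]; linarith
  have hmF : m * (1 / m) = 1 := by field_simp
  have hF_pos : 0 < 1 / m := by positivity
  -- exponent bookkeeping
  have hE : Real.exp (1 - 1 / m) * Real.exp (-1) = Real.exp (-(1 / m)) := by
    rw [← Real.exp_add]; ring_nf
  refine ⟨a, m, s, 2, 1 / m, 1, η, 1 / m, 1, ⟨ha_pos, hm, hs_pos, by simp only [ha_def]; ring⟩,
    ⟨⟨hη_pos, hη_le⟩, ⟨hF_pos, le_rfl⟩, ⟨one_pos, le_rfl⟩⟩, ?_, ?_, ?_, ?_, ?_⟩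
  · -- (i) `aη + m·(1/m) + s = (1 − s) + 1 + s = 2`
    rw [haη, hmF]; ring
  · -- (ii) `0 + (1 − 2m)e^{-1/m} − s e^{-1} = 0`
    have h1 : m * ((1 / m - 2) * Real.exp (-(1 / m))) = (1 - 2 * m) * Real.exp (-(1 / m)) := by
      have : m * (1 / m - 2) = 1 - 2 * m := by field_simp
      rw [← mul_assoc, this]
    rw [h1, hs_def]
    have : (1 - 2 * m) * Real.exp (1 - 1 / m) * (((1 : ℝ) - 2) * Real.exp (-1))
        = -((1 - 2 * m) * (Real.exp (1 - 1 / m) * Real.exp (-1))) := by ring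
    rw [this, hE]
    simp
  · -- (iii) `Z/V ≥ a e^{-2} ≥ (1 − 2m) e^{-2}`
    have h1 : (1 - 2 * m) * Real.exp (-2) ≤ a * Real.exp (-2) := by
      apply mul_le_mul_of_nonneg_right _ (Real.exp_pos _).le
      simp only [ha_def]; linarith
    have h2 : 0 ≤ m * Real.exp (-(1 / m)) := by positivity
    have h3 : 0 ≤ s * Real.exp (-1) := by positivity
    linarith
  · -- Jensen `Z/V ≤ e^{-2}`: `m e^{-1/m} + s e^{-1} = (1 − m) e^{-1/m} ≤ m e^{-2} ≤ (m + s) e^{-2}`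
    have hsE : s * Real.exp (-1) = (1 - 2 * m) * Real.exp (-(1 / m)) := by
      rw [hs_def, mul_assoc, hE]
    -- `(1 − m) e^{-1/m} ≤ m e^{-2}` ⟸ `(1/m − 1) ≤ e^{1/m − 2}`
    have hx : 1 / m - 2 + 1 ≤ Real.exp (1 / m - 2) := Real.add_one_le_exp _
    have hkey : (1 - m) * Real.exp (-(1 / m)) ≤ m * Real.exp (-2) := by
      have hE2 : Real.exp (1 / m - 2) * Real.exp (-(1 / m)) = Real.exp (-2) := by
        rw [← Real.exp_add]; ring_nf
      have h1 : (1 - m) = m * (1 / m - 2 + 1) := by field_simp; ring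
      calc (1 - m) * Real.exp (-(1 / m)) = m * (1 / m - 2 + 1) * Real.exp (-(1 / m)) := by rw [← h1]
        _ ≤ m * Real.exp (1 / m - 2) * Real.exp (-(1 / m)) := by
            apply mul_le_mul_of_nonneg_right _ (Real.exp_pos _).le
            exact mul_le_mul_of_nonneg_left hx hm.le
        _ = m * Real.exp (-2) := by rw [mul_assoc, hE2]
    have hsm : m * Real.exp (-2) ≤ (m + s) * Real.exp (-2) :=
      mul_le_mul_of_nonneg_right (by linarith) (Real.exp_pos _).le
    have hsum : a * Real.exp (-2) + m * Real.exp (-(1 / m)) + s * Real.exp (-1)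
        = a * Real.exp (-2) + (1 - m) * Real.exp (-(1 / m)) := by rw [hsE]; ring
    rw [hsum]
    have ha1 : a + (m + s) = 1 := by simp only [ha_def]; ring
    nlinarith [Real.exp_pos (-2 : ℝ)]
  · -- variance `≥ m (1/m − 2)² = (1 − 2m)²/m ≥ 1/(4m)`
    have h1 : m * (1 / m - 2) ^ 2 = (1 - 2 * m) ^ 2 / m := by field_simp
    have h2 : 1 / (4 * m) ≤ (1 - 2 * m) ^ 2 / m := by
      rw [div_le_div_iff₀ (by positivity) hm]
      nlinarith
    have h3 : 0 ≤ a * (η - 2) ^ 2 := by positivity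
    have h4 : 0 ≤ s * ((1 : ℝ) - 2) ^ 2 := by positivity
    linarith [h1]


end Summit.SmoothPoincare4.SmoothPoincare4.Theorems.CompactShrinkerGap.Negative
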